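import Mathlib
import Literature.LinearAlgebra.Matrix.SylvesterDeterminantIdentity
import Summits.ValiantsHypothesis.ValiantsHypothesis.Theorems.KPlusLogSqLawWeakLiftingTowerGraftMinorPencil
import Summits.ValiantsHypothesis.ValiantsHypothesis.Theorems.KPlusLogSqLawWeakLiftingTowerGraftSupportLevelT5False

/-!
# Tower graft line — RANK-CHARGED VANISHING of the minor pencil's letters (first «charge by minor structure»)

Mechanism piece for LINE (B) `Cruxes/WeakLifting/Lines/tower_graft.lean` (rev 9; crux `WeakLifting` = stmt-ValiantsHypothesis-19561,
restricted sub-case `TowerWeakLifting`), S4f / T5 side; planner val-idea-24 g0 GO 19:48:47Z ((h2′) of the minor-pencil handles).  NO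
registered stub is closed.  Context: the Sylvester minor pencil of `G = Σₗ X^{dₗ} Sₗ` is the lacunary pencil
`𝔅 = Σ_{f : ι ⊕ Unit → Fin K} X^{Σ_a d (f a)} • T_f` (`borderedMinors_pencil_eq_sum`, p660533), and a true T5 must charge the MINOR
structure of the letters `T_f` — the support alone cannot carry it (`not_supportLevel_T5`, p662294).  The simplest such charge:

* `det_eq_zero_of_rank_lt_card_fiber` — a square matrix whose columns labelled by a fibre `f ⁻¹ l` are row-restricted columns of a matrix
  of rank `< |f ⁻¹ l|` is singular (`linearIndependent_cols_of_det_ne_zero` + `Matrix.rank_submatrix_le`).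
* `minorPencil_letter_eq_zero_of_rank_lt` — hence **`T_f = 0` as soon as some letter `l` is used by the colouring `f` more than
  `rank (S l)` times**.
* `borderedMinors_pencil_eq_sum_rankAdmissible` — so `𝔅` is the pencil over the RANK-ADMISSIBLE colourings only
  (`∀ l, |f ⁻¹ l| ≤ rank (S l)`); `coeff_borderedMinors_eq_zero_of_not_rankAdmissible` — every entry of `𝔅` is supported on the
  exponents of rank-admissible colourings; `card_rankAdmissible_exponents_le` — their number is at most
  `#{n : Fin K → ℕ : Σ n = |ι|+1, nₗ ≤ rank (S l)}` (e.g. rank-one letters enter each surviving exponent at most once: with only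
  rank-`r` letters the digit vectors are bounded by `r`).

Def-free.  Proves no stub and nothing about `WeakLifting`, Conjecture B / `KPlusLogSqLaw`, `MatrixDescartes` (18050) or `VP ≠ VNP`.
Seat: prover val-sym-lift-p3 g17, `--supports stmt-ValiantsHypothesis-19561`.
-/

-- `Summit.ValiantsHypothesis.ValiantsHypothesis.…` repeats a component by the D-0017 layout
-- (single-conjunct summit), which the `dupNamespace` linter flags; the name is mandated.
set_option linter.dupNamespace false

namespace Summit.ValiantsHypothesis.ValiantsHypothesis.Theorems.KPlusLogSqLaw.TowerGraft

open Finset Matrix Polynomial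
open scoped BigOperators Polynomial
open Literature.LinearAlgebra.Matrix (borderedMinors)

/-- **a square matrix whose columns with labels in a fibre `f ⁻¹ l` are drawn from the columns of a matrix of rank `< |f ⁻¹ l|` is
singular.**  Columns `b` of `M` with `f b = l` are (row-restricted) columns of `S l`; if there are more of them than `rank (S l)`,
they are dependent. [folklore] -/
theorem det_eq_zero_of_rank_lt_card_fiber {α N : Type*} [Fintype α] [DecidableEq α] [Fintype N] [DecidableEq N] {K : ℕ}
    (S : Fin K → Matrix N N ℝ) (f : α → Fin K) (ρ γ : α → N) (l : Fin K)
    (hl : (S l).rank < (Finset.univ.filter (fun b => f b = l)).card) :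
    (Matrix.of fun a b => S (f b) (ρ a) (γ b)).det = 0 := by
  classical
  by_contra hdet
  set M : Matrix α α ℝ := Matrix.of fun a b => S (f b) (ρ a) (γ b) with hM
  -- the columns of `M` are linearly independent
  have hcols : LinearIndependent ℝ M.col := linearIndependent_cols_of_det_ne_zero hdet
  -- restrict to the fibre of `l`
  set ι' := {b : α // f b = l} with hι'
  have hsub : M.submatrix id (Subtype.val : ι' → α) = (S l).submatrix ρ (γ ∘ Subtype.val) := by
    ext a b
    simp only [hM, Matrix.submatrix_apply, Matrix.of_apply, id, Function.comp_apply, b.2]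
  have hindep : LinearIndependent ℝ (M.submatrix id (Subtype.val : ι' → α)).col := by
    have h1 : (M.submatrix id (Subtype.val : ι' → α)).col = M.col ∘ (Subtype.val : ι' → α) := by
      funext b
      rfl
    rw [h1]
    exact hcols.comp _ Subtype.val_injective
  have hrank : (M.submatrix id (Subtype.val : ι' → α)).rank = Fintype.card ι' := by
    rw [Matrix.rank_eq_finrank_span_cols, finrank_span_eq_card hindep]
  have hle : (M.submatrix id (Subtype.val : ι' → α)).rank ≤ (S l).rank := by
    rw [hsub]
    exact Matrix.rank_submatrix_le _ _ _
  have hcard : Fintype.card ι' = (Finset.univ.filter (fun b => f b = l)).card := Fintype.card_subtype _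
  omega

/-- **RANK-CHARGED VANISHING of the minor pencil's letters** (a first «charge by MINOR structure», cf. `borderedMinors_pencil_eq_sum` in
`…TowerGraftMinorPencil`): the letter `T_f` of the Sylvester minor pencil attached to a colouring `f : ι ⊕ Unit → Fin K` VANISHES
identically as soon as some letter `l` is used by `f` more than `rank (S l)` times.  So the support of `𝔅` is pruned from the full
`(|ι|+1)`-fold sumset to colourings whose multiplicities are bounded by the ranks of the letters. [this work] -/
theorem minorPencil_letter_eq_zero_of_rank_lt {ι μ : Type*} [Fintype ι] [DecidableEq ι] {N K : ℕ} (e : ι ⊕ μ ≃ Fin N)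
    (S : Fin K → Matrix (Fin N) (Fin N) ℝ) (f : ι ⊕ Unit → Fin K) (l : Fin K)
    (hl : (S l).rank < (Finset.univ.filter (fun b => f b = l)).card) :
    (Matrix.of fun i j : μ => Matrix.det (Matrix.of fun a b : ι ⊕ Unit =>
        S (f b) (e (Sum.map id (fun _ : Unit => i) a)) (e (Sum.map id (fun _ : Unit => j) b)))) = 0 := by
  ext i j
  rw [Matrix.of_apply, Matrix.zero_apply]
  exact det_eq_zero_of_rank_lt_card_fiber S f _ _ l hl


/-- **THE MINOR PENCIL LIVES ON RANK-ADMISSIBLE COLOURINGS**: in the letter decomposition of `𝔅` only the colourings `f` with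
`|f ⁻¹ l| ≤ rank (S l)` for every letter `l` contribute. [this work] -/
theorem borderedMinors_pencil_eq_sum_rankAdmissible {ι μ : Type*} [Fintype ι] [DecidableEq ι] {N K : ℕ} (e : ι ⊕ μ ≃ Fin N)
    (d : Fin K → ℕ) (S : Fin K → Matrix (Fin N) (Fin N) ℝ) :
    let A := (∑ l, ((X : ℝ[X]) ^ d l) • (S l).map Polynomial.C).submatrix e e
    borderedMinors A.toBlocks₁₁ A.toBlocks₁₂ A.toBlocks₂₁ A.toBlocks₂₂ =
      ∑ f ∈ Finset.univ.filter (fun f : ι ⊕ Unit → Fin K => ∀ l, (Finset.univ.filter (fun b => f b = l)).card ≤ (S l).rank),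
        ((X : ℝ[X]) ^ (∑ a, d (f a))) •
          (Matrix.of fun i j : μ => Matrix.det (Matrix.of fun a b : ι ⊕ Unit =>
            S (f b) (e (Sum.map id (fun _ : Unit => i) a)) (e (Sum.map id (fun _ : Unit => j) b)))).map Polynomial.C := by
  intro A
  rw [borderedMinors_pencil_eq_sum e d S, ← Finset.sum_filter_add_sum_filter_not Finset.univ
    (fun f : ι ⊕ Unit → Fin K => ∀ l, (Finset.univ.filter (fun b => f b = l)).card ≤ (S l).rank)]
  conv_rhs => rw [← add_zero (Finset.sum _ _)]
  congr 1
  refine Finset.sum_eq_zero fun f hf => ?_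
  obtain ⟨l, hl⟩ := not_forall.mp (Finset.mem_filter.mp hf).2
  rw [minorPencil_letter_eq_zero_of_rank_lt e S f l (not_le.mp hl)]
  simp

/-- hence every entry of `𝔅` is supported on the exponents of RANK-ADMISSIBLE colourings. [this work] -/
theorem coeff_borderedMinors_eq_zero_of_not_rankAdmissible {ι μ : Type*} [Fintype ι] [DecidableEq ι] {N K : ℕ} (e : ι ⊕ μ ≃ Fin N)
    (d : Fin K → ℕ) (S : Fin K → Matrix (Fin N) (Fin N) ℝ) (i j : μ) {x : ℕ}
    (hx : ∀ f : ι ⊕ Unit → Fin K, (∀ l, (Finset.univ.filter (fun b => f b = l)).card ≤ (S l).rank) → (∑ a, d (f a)) ≠ x) :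
    let A := (∑ l, ((X : ℝ[X]) ^ d l) • (S l).map Polynomial.C).submatrix e e
    (borderedMinors A.toBlocks₁₁ A.toBlocks₁₂ A.toBlocks₂₁ A.toBlocks₂₂ i j).coeff x = 0 := by
  intro A
  have h := borderedMinors_pencil_eq_sum_rankAdmissible e d S
  simp only [] at h
  rw [h, Matrix.sum_apply, Polynomial.finsetSum_coeff]
  refine Finset.sum_eq_zero fun f hf => ?_
  have hadm := (Finset.mem_filter.mp hf).2
  rw [Matrix.smul_apply, Matrix.map_apply, smul_eq_mul, mul_comm, Polynomial.coeff_C_mul_X_pow, if_neg (fun hx' => hx f hadm hx'.symm)]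

/-- **the surviving exponents are counted by rank-bounded class-count vectors**: the number of distinct exponents of rank-admissible
colourings is at most `#{n : Fin K → ℕ : Σ n = |ι ⊕ Unit|, nₗ ≤ rank (S l)}`. [this work] -/
theorem card_rankAdmissible_exponents_le {ι : Type*} [Fintype ι] [DecidableEq ι] {N K : ℕ} (d : Fin K → ℕ)
    (S : Fin K → Matrix (Fin N) (Fin N) ℝ) :
    ((Finset.univ.filter (fun f : ι ⊕ Unit → Fin K => ∀ l, (Finset.univ.filter (fun b => f b = l)).card ≤ (S l).rank)).image
        (fun f => ∑ a, d (f a))).card ≤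
      ((Fintype.piFinset fun l : Fin K => Finset.range ((S l).rank + 1)).filter
        (fun n => ∑ l, n l = Fintype.card (ι ⊕ Unit))).card := by
  classical
  -- the exponent of `f` only depends on its class-count vector, which is rank-bounded for admissible `f`
  set cnt : (ι ⊕ Unit → Fin K) → (Fin K → ℕ) := fun f l => (Finset.univ.filter (fun b => f b = l)).card with hcnt
  have hsub : (Finset.univ.filter (fun f : ι ⊕ Unit → Fin K => ∀ l, (Finset.univ.filter (fun b => f b = l)).card ≤ (S l).rank)).image
        (fun f => ∑ a, d (f a)) ⊆
      (((Fintype.piFinset fun l : Fin K => Finset.range ((S l).rank + 1)).filter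
        (fun n => ∑ l, n l = Fintype.card (ι ⊕ Unit))).image (fun n => ∑ l, n l * d l)) := by
    intro x hx
    obtain ⟨f, hf, rfl⟩ := Finset.mem_image.mp hx
    have hadm := (Finset.mem_filter.mp hf).2
    refine Finset.mem_image.mpr ⟨cnt f, ?_, (sum_colouring_eq_sum_card_fiber d f).symm⟩
    refine Finset.mem_filter.mpr ⟨?_, sum_card_fiber_eq_card f⟩
    exact Fintype.mem_piFinset.mpr fun l => Finset.mem_range.mpr (Nat.lt_succ_of_le (hadm l))
  exact (Finset.card_le_card hsub).trans Finset.card_image_le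

end Summit.ValiantsHypothesis.ValiantsHypothesis.Theorems.KPlusLogSqLaw.TowerGraft
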